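import Summits.QuantumFields.YangMills.Theorems.BalabanUVNodesN11NoExpansionGeneralStepRePinned
import Summits.QuantumFields.YangMills.Theorems.BalabanUVNodesN11RePinnedOldBranchMeasurable
import Summits.QuantumFields.YangMills.Theorems.BalabanUVNodesN11NoExpansionOldBranchIntegrable
import Summits.QuantumFields.YangMills.Theorems.BalabanUVNodesN11DiagonalBranchIntegrable

/-!
# DAG node N11 — THE OFF-DIAGONAL RESIDUE OF THE NO-EXPANSION 𝐓-STEP, STATED: at the re-pinned parameter `rePinH θ` every KERNEL-side binder of the general-history
# step is discharged; what remains are three displayed properties of the §2 TERM DATA at the old sequence (locality of the old action in the fluctuation argument,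
# measurability of the old operand, integrability of the old branches)

WHY.  g9 closed the diagonal (`…N11DiagonalStepNoBinders`, and dag-n11-e's induction consuming it).  Off the diagonal — histories with a small-field step below `k` —
this seat's A1∕A2∕B files supply the A6 inhabitant of the residual-slot binders (`rePinH θ`), C3 reduces the old-branch measurability to measurability of the OPERAND,
and the `…Integrable` chain replaced the unprovable sup bound by integrability.  This file composes them into ONE statement whose remaining hypotheses mention the §2
term data `Sect2.TermValues` only — the honest hand-over line between dag-n11-d (kernel bookkeeping, done) and def-T∕K0b (laws of the term values, not in the tree).

WHAT THIS FILE PROVES (0 `sorry`, 0 `def`).  `clause_succ_rePinH_of_Omega_empty_of_oldBranch_of_clause_of_integrable` (p553094 §3 with `hCB ↦ hIB`); ★★★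
`exists_clause_succ_rePinH_of_Omega_empty_of_sLaw₁₃CoPH_of_termLaws` (keyed on `SLaw₁₃CoPH (rePinH θ) p k`; binders `hA`, `hΦm`, `hIB` only).  §2 A6 exhibit:
`exists_clause_succ_rePinH_door_ofCured_of_allLarge_of_core` — on the all-large diagonal at the re-pinned door of K0a's cured witness the three binders are inhabited
(`hA_of_allLarge`, `measurable_sect2Operand_CoP_of_allLarge`, `integrable_tkBranch_door_of_allLarge`), so the clause follows from `Provisos₁₃Core` + `SLaw` + `k < K` + `1 ≤ M`.
HONEST SCOPE.  Helper lane of K1⁷ `stmt-QuantumFields-20542` (dag-n11-d g9); count-neutral kernel bookkeeping; nothing of Bałaban's estimates; director-ym №186 (1)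
respected (`rePinH θ` is a certificate value, no law of record for `Zh` at `k ≥ 1` is posited); sequences with `Ω_{k+1}(s′) ≠ ∅` are [III] §3 + Thm 2 proper.  N11 is NOT
discharged; counts unmoved (typed 28∕28 · discharged 5∕27).  One finite four-torus programme at fixed `ε = L^{−K}`; NOT ℝ⁴, NOT OS, NOT a mass gap, NOT Clay.
Sources: [III] Theorem p. 245, Theorem 1 p. 262, (3.24)–(3.25) p. 270, (2.18) p. 257, (2.20)–(2.25) pp. 258–259, (3.16) p. 268.
-/

noncomputable section

open MeasureTheory
open scoped BigOperators Matrix.Norms.L2Operator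

namespace Summit.QuantumFields.YangMills.Theorems.BalabanUVNodesN11NoExpansionGeneralStepRePinnedIntegrable

open Literature.MathematicalPhysics.QuantumFieldTheory.Balaban1983to89 T4Continuum Node00 Node00.Tk DagBinding
open B15DeterminingSets
open BalabanUVNodesN11HistoryPinnedResidualDefs BalabanUVNodesN11RePinnedParamDefs
open BalabanUVNodesN11NoExpansionOldBranchIntegrable (clause_succ_CoPH_of_Omega_empty_of_pinChi_of_oldBranch_of_clause_of_integrable)
open BalabanUVNodesN11RePinnedOldBranchMeasurable (hmB_rePinH_of_measurable_operand)
open BalabanUVNodesN11NoExpansionGeneralStepRePinned (WtOfRecord₁₃H_rePinH_door_seqAllLarge)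
open BalabanUVNodesN11NoExpansionAllLargeCoP (init_allLarge admSOfRecord_init_eq_of_allLarge)
open BalabanUVNodesN11NoExpansionGeneralStepCoPHDoor (hA_of_allLarge)
open BalabanUVNodesN11DiagonalOldBranchMeasurable (measurable_sect2Operand_CoP_of_allLarge)
open BalabanUVNodesN11DiagonalBranchIntegrable (integrable_tkBranch_door_of_allLarge)

variable {F : T4Family} {N : ℕ} [NeZero N]

section RePinned

variable (θ : Stage13HParams F N) (p : B12.RunParams)

/-- **★★ THE GENERAL-HISTORY NO-EXPANSION 𝐓-STEP AT THE RE-PINNED PARAMETER, OLD-BRANCH FORM, GRAPH-INTEGRABLE** (`…N11NoExpansionOldBranchIntegrable`'s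
`clause_succ_CoPH_of_Omega_empty_of_pinChi_of_oldBranch_of_clause_of_integrable` at `rePinH θ`): measurability `hmB` and INTEGRABILITY `hIB` of the OLD branch
`U ↦ 𝐓_k(init s′, S)[e^{A_k(init s′)}](U)` displayed; (P), (V), `hq`, `hqloc` DISCHARGED (p553094's faces). [cite: Balaban1988Convergent, Theorem p.245, (3.24)–(3.25) p.270, (2.18) p.257, (2.20)–(2.25) pp.258–259, (3.16) p.268] -/
theorem clause_succ_rePinH_of_Omega_empty_of_oldBranch_of_clause_of_integrable (h : θ.Provisos₁₃CoPH F N) {k : ℕ} (hk : k < p.K) (hM : 1 ≤ θ.τ9.M)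
    (s : SeqOfRecord F θ.ν θ.τ9.M (gOfRecord₁₃ F N θ.toStage13Params p) p.K (k + 1)) (hΩ : s.Ω (k + 1) = ∅)
    (t : Sect2.TermValues (F.P p.K) (MatA N) (FluctV N) θ.τ9.M) (E₀ : ℝ)
    (hA : ∀ (S : ℕ → Set (Site (F.P p.K) 0)) (a a' : Tk.MSFluct (F.P p.K) (FluctV N)) (Uf : GaugeField (F.P p.K) 0 (SU N)), (∀ i, i ≤ k → a i = a' i) →
      (sect2ActionDataOfRecord F N (FluctV N) p.K (settingOfRecord₁₃ F N θ.toStage13Params p) (θ.rzAt p s.init) s.init t (S, a) E₀).action23 k Uf =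
        (sect2ActionDataOfRecord F N (FluctV N) p.K (settingOfRecord₁₃ F N θ.toStage13Params p) (θ.rzAt p s.init) s.init t (S, a') E₀).action23 k Uf)
    (hid : slotsOfRecord F N θ.ν θ.τ9 (EOfRecord₁₃ F N θ.toStage13Params) (wOfRecord₉ F N θ.toStage9Params) θ.ppSel p
        (gOfRecord₁₃ F N θ.toStage13Params p) k s.init = 0 ∨
      ∀ᵐ U₀ ∂fieldMeasure (F.P p.K) k (SU N),
        chiSeqOfRecord F N θ.ν θ.τ9.M (gOfRecord₁₃ F N θ.toStage13Params p) p.K k s.init U₀ ≠ 0 →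
          slotsOfRecord F N θ.ν θ.τ9 (EOfRecord₁₃ F N θ.toStage13Params) (wOfRecord₉ F N θ.toStage9Params) θ.ppSel p
              (gOfRecord₁₃ F N θ.toStage13Params p) k s.init U₀ =
            sect2Slot F N (FluctV N) p.K (settingOfRecord₁₃ F N θ.toStage13Params p) (θ.rzAt p s.init) (WtOfRecord₁₃H F N (rePinH θ) p s.init) s.init t E₀
              (UbgOfRecord₁₃CoP F N θ.toStage13Params p k s.init) U₀)
    (hmB : ∀ S ∈ admSOfRecord F θ.ν θ.τ9.M (gOfRecord₁₃ F N θ.toStage13Params p) p.K k s.init,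
      Measurable fun U₀ : GaugeField (F.P p.K) k (SU N) =>
        tkBranchOfRecord F N (FluctV N) θ.ν θ.τ9.M _ p.K (WtOfRecord₁₃H F N (rePinH θ) p s) s.init S k
          (fun ω => sect2Operand F N (FluctV N) p.K (settingOfRecord₁₃ F N θ.toStage13Params p) (θ.rzAt p s.init) s.init t E₀
            (UbgOfRecord₁₃CoP F N θ.toStage13Params p k s.init) (S, fun j => (ω j).2) (fun j => (ω j).1))
          (baseCfg (V := FluctV N) k U₀))
    (hIB : ∀ S ∈ admSOfRecord F θ.ν θ.τ9.M (gOfRecord₁₃ F N θ.toStage13Params p) p.K k s.init,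
      Integrable (fun U₀ : GaugeField (F.P p.K) k (SU N) =>
        tkBranchOfRecord F N (FluctV N) θ.ν θ.τ9.M _ p.K (WtOfRecord₁₃H F N (rePinH θ) p s) s.init S k
          (fun ω => sect2Operand F N (FluctV N) p.K (settingOfRecord₁₃ F N θ.toStage13Params p) (θ.rzAt p s.init) s.init t E₀
            (UbgOfRecord₁₃CoP F N θ.toStage13Params p k s.init) (S, fun j => (ω j).2) (fun j => (ω j).1))
          (baseCfg (V := FluctV N) k U₀)) (fieldMeasure (F.P p.K) k (SU N))) :
    slotsTOfRecord F N θ.ν θ.τ9 (EOfRecord₁₃ F N θ.toStage13Params) (wOfRecord₉ F N θ.toStage9Params) θ.ppSel p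
        (gOfRecord₁₃ F N θ.toStage13Params p) (k + 1) s = 0 ∨
      ∀ᵐ V' ∂fieldMeasure (F.P p.K) (k + 1) (SU N),
        chiSeqOfRecord F N θ.ν θ.τ9.M (gOfRecord₁₃ F N θ.toStage13Params p) p.K (k + 1) s V' ≠ 0 →
          slotsTOfRecord F N θ.ν θ.τ9 (EOfRecord₁₃ F N θ.toStage13Params) (wOfRecord₉ F N θ.toStage9Params) θ.ppSel p
              (gOfRecord₁₃ F N θ.toStage13Params p) (k + 1) s V' =
            sect2Slot F N (FluctV N) p.K (settingOfRecord₁₃ F N θ.toStage13Params p) (θ.rzAt p s) (WtOfRecord₁₃H F N (rePinH θ) p s) s t E₀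
              (UbgOfRecord₁₃CoP F N θ.toStage13Params p (k + 1) s) V' :=
  clause_succ_CoPH_of_Omega_empty_of_pinChi_of_oldBranch_of_clause_of_integrable (rePinH θ) p (provisos₁₃CoPH_rePinH h) hk hM s hΩ
    (fun _ _ _ _ _ => rfl) (prefix_agree_rePinH θ p s hΩ) t E₀ hA hid (zhAt_rePinH_ζ0_univ_pairCfgAt θ p hk s hΩ) (fun _ _ => rfl) hmB hIB

/-- **★★★ THE OFF-DIAGONAL RESIDUE OF N11's NO-EXPANSION 𝐓-STEP, STATED**: at the re-pinned parameter `rePinH θ` (`θ.Provisos₁₃CoPH`, `1 ≤ M`, `k < K`) and ANY history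
`s′` with `Ω_{k+1}(s′) = ∅`, `SLaw₁₃CoPH (rePinH θ) p k` implies the 𝐓-image clause at `s′` PROVIDED ONLY three properties of the §2 TERM DATA at `init s′` hold —
(hA) the old (2.23) action is `k`-local in the fluctuation argument, (hΦm) the old operand `ω ↦ exp A_k(init s′)(S, ·)(ω)` is measurable on the multiscale
configuration space, (hIB) the old branches are `dU_k`-integrable.  Every KERNEL-side binder is discharged: (P)∕(V)∕`hq`∕`hqloc` by `…N11RePinnedParamDefs`, `hmB` from
(hΦm) by `…N11RePinnedOldBranchMeasurable.hmB_rePinH_of_measurable_operand`, the sup bound by the `…Integrable` re-typing.  On the all-large diagonal all three hold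
(`…N11DiagonalStepNoBinders`); off it they are statements about `Sect2.TermValues`, for which the tree has no measurability law — NOT claimed.
[cite: Balaban1988Convergent, Theorem p.245, Thm 1 p.262, (3.24)–(3.25) p.270, (2.23) p.258] -/
theorem exists_clause_succ_rePinH_of_Omega_empty_of_sLaw₁₃CoPH_of_termLaws (h : θ.Provisos₁₃CoPH F N) {k : ℕ} (hk : k < p.K) (hM : 1 ≤ θ.τ9.M)
    (hS : SLaw₁₃CoPH F N (rePinH θ) p k)
    (s : SeqOfRecord F θ.ν θ.τ9.M (gOfRecord₁₃ F N θ.toStage13Params p) p.K (k + 1)) (hΩ : s.Ω (k + 1) = ∅)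
    (hA : ∀ (t₀ : Sect2.TermValues (F.P p.K) (MatA N) (FluctV N) θ.τ9.M) (E₀ : ℝ) (S : ℕ → Set (Site (F.P p.K) 0))
      (a a' : Tk.MSFluct (F.P p.K) (FluctV N)) (Uf : GaugeField (F.P p.K) 0 (SU N)), (∀ i, i ≤ k → a i = a' i) →
      (sect2ActionDataOfRecord F N (FluctV N) p.K (settingOfRecord₁₃ F N θ.toStage13Params p) (θ.rzAt p s.init) s.init t₀ (S, a) E₀).action23 k Uf =
        (sect2ActionDataOfRecord F N (FluctV N) p.K (settingOfRecord₁₃ F N θ.toStage13Params p) (θ.rzAt p s.init) s.init t₀ (S, a') E₀).action23 k Uf)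
    (hΦm : ∀ (t₀ : Sect2.TermValues (F.P p.K) (MatA N) (FluctV N) θ.τ9.M) (E₀ : ℝ) (S : ℕ → Set (Site (F.P p.K) 0)),
      Measurable fun ω : MultiCfg (F.P p.K) (SU N) (FluctV N) =>
        sect2Operand F N (FluctV N) p.K (settingOfRecord₁₃ F N θ.toStage13Params p) (θ.rzAt p s.init) s.init t₀ E₀
          (UbgOfRecord₁₃CoP F N θ.toStage13Params p k s.init) (S, fun j => (ω j).2) (fun j => (ω j).1))
    (hIB : ∀ (t₀ : Sect2.TermValues (F.P p.K) (MatA N) (FluctV N) θ.τ9.M) (E₀ : ℝ),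
      ∀ S ∈ admSOfRecord F θ.ν θ.τ9.M (gOfRecord₁₃ F N θ.toStage13Params p) p.K k s.init,
      Integrable (fun U₀ : GaugeField (F.P p.K) k (SU N) =>
        tkBranchOfRecord F N (FluctV N) θ.ν θ.τ9.M _ p.K (WtOfRecord₁₃H F N (rePinH θ) p s) s.init S k
          (fun ω => sect2Operand F N (FluctV N) p.K (settingOfRecord₁₃ F N θ.toStage13Params p) (θ.rzAt p s.init) s.init t₀ E₀
            (UbgOfRecord₁₃CoP F N θ.toStage13Params p k s.init) (S, fun j => (ω j).2) (fun j => (ω j).1))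
          (baseCfg (V := FluctV N) k U₀)) (fieldMeasure (F.P p.K) k (SU N))) :
    ∃ (t₀ : Sect2.TermValues (F.P p.K) (MatA N) (FluctV N) θ.τ9.M) (E' : ℝ),
      slotsTOfRecord F N θ.ν θ.τ9 (EOfRecord₁₃ F N θ.toStage13Params) (wOfRecord₉ F N θ.toStage9Params) θ.ppSel p
          (gOfRecord₁₃ F N θ.toStage13Params p) (k + 1) s = 0 ∨
        ∀ᵐ V' ∂fieldMeasure (F.P p.K) (k + 1) (SU N),
          chiSeqOfRecord F N θ.ν θ.τ9.M (gOfRecord₁₃ F N θ.toStage13Params p) p.K (k + 1) s V' ≠ 0 →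
            slotsTOfRecord F N θ.ν θ.τ9 (EOfRecord₁₃ F N θ.toStage13Params) (wOfRecord₉ F N θ.toStage9Params) θ.ppSel p
                (gOfRecord₁₃ F N θ.toStage13Params p) (k + 1) s V' =
              sect2Slot F N (FluctV N) p.K (settingOfRecord₁₃ F N θ.toStage13Params p) (θ.rzAt p s) (WtOfRecord₁₃H F N (rePinH θ) p s) s t₀ E'
                (UbgOfRecord₁₃CoP F N θ.toStage13Params p (k + 1) s) V' := by
  obtain ⟨t, Ek, -, hs⟩ := (sLaw₁₃CoPH_iff F N (rePinH θ) p k).1 hS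
  exact ⟨t s.init, Ek s.init, clause_succ_rePinH_of_Omega_empty_of_oldBranch_of_clause_of_integrable θ p h hk hM s hΩ (t s.init) (Ek s.init)
    (hA _ _) (hs s.init).2 (fun S _ => hmB_rePinH_of_measurable_operand θ p h s S (hΦm _ _ S)) (hIB _ _)⟩

end RePinned

/-! ## §2  A6 exhibit: on the all-large-field diagonal at the re-pinned door of K0a's cured witness the three term-law binders ARE inhabited -/

section Door

variable (p : B12.RunParams) (θ₀ : Stage13Params F N)

/-- **★ THE THREE TERM-LAW BINDERS OF §1 ARE INHABITED ON THE DIAGONAL** (A6 exhibit): at the re-pinned door `rePinH (ofHistoryBlind (ofCured θ₀))` and the all-large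
history, (hA) holds by term-freeness of the (2.23) action (`hA_of_allLarge`), (hΦm) because the operand is `exp(−g₀⁻²A((ω 0).1) − E)` (`measurable_sect2Operand_CoP_of_allLarge`),
and (hIB) by `…N11DiagonalBranchIntegrable` (the re-pinned door's weights at an all-large index ARE the door's, `WtOfRecord₁₃H_rePinH_door_seqAllLarge`) — so §1 yields the
diagonal 𝐓-step at the RE-PINNED door from `θ₀.Provisos₁₃Core` + `SLaw₁₃CoPH (rePinH door) p k` + `k < K` + `1 ≤ M` alone (companion of `…N11DiagonalStepNoBinders`, which is
the same statement at the door itself). [cite: Balaban1988Convergent, Theorem 1 p.262, Theorem p.245, (3.24)–(3.25) p.270, (2.20)–(2.23) p.258, (1.11) p.248] -/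
theorem exists_clause_succ_rePinH_door_ofCured_of_allLarge_of_core (h : θ₀.Provisos₁₃Core F N) {k : ℕ} (hk : k < p.K) (hM : 1 ≤ θ₀.τ9.M)
    (hS : SLaw₁₃CoPH F N (rePinH (Stage13HParams.ofHistoryBlind F N (Stage13RParams.ofCured F N θ₀))) p k)
    (s : SeqOfRecord F θ₀.ν θ₀.τ9.M (gOfRecord₁₃ F N θ₀ p) p.K (k + 1)) (hall : ∀ j, 1 ≤ j → j ≤ k + 1 → s.Ω j = ∅) :
    ∃ (t₀ : Sect2.TermValues (F.P p.K) (MatA N) (FluctV N) θ₀.τ9.M) (E' : ℝ),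
      slotsTOfRecord F N θ₀.ν θ₀.τ9 (EOfRecord₁₃ F N θ₀) (wOfRecord₉ F N θ₀.toStage9Params) θ₀.ppSel p (gOfRecord₁₃ F N θ₀ p) (k + 1) s = 0 ∨
        ∀ᵐ V' ∂fieldMeasure (F.P p.K) (k + 1) (SU N),
          chiSeqOfRecord F N θ₀.ν θ₀.τ9.M (gOfRecord₁₃ F N θ₀ p) p.K (k + 1) s V' ≠ 0 →
            slotsTOfRecord F N θ₀.ν θ₀.τ9 (EOfRecord₁₃ F N θ₀) (wOfRecord₉ F N θ₀.toStage9Params) θ₀.ppSel p (gOfRecord₁₃ F N θ₀ p) (k + 1) s V' =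
              sect2Slot F N (FluctV N) p.K (settingOfRecord₁₃ F N θ₀ p) (θ₀.Rz p.K)
                (WtOfRecord₁₃H F N (rePinH (Stage13HParams.ofHistoryBlind F N (Stage13RParams.ofCured F N θ₀))) p s) s t₀ E'
                (UbgOfRecord₁₃CoP F N θ₀ p (k + 1) s) V' := by
  obtain rfl : s = seqAllLargeOfRecord F θ₀.ν θ₀.τ9.M (gOfRecord₁₃ F N θ₀ p) p.K (k + 1) :=
    BalabanUVNodesN11ResidualPinCompletion.seq_eq_seqAllLargeOfRecord θ₀.ν θ₀.τ9.M _ p.K (k + 1) s hall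
  have hinit : (seqAllLargeOfRecord F θ₀.ν θ₀.τ9.M (gOfRecord₁₃ F N θ₀ p) p.K (k + 1)).init =
      seqAllLargeOfRecord F θ₀.ν θ₀.τ9.M (gOfRecord₁₃ F N θ₀ p) p.K k :=
    BalabanUVNodesN11ResidualPinCompletion.seq_eq_seqAllLargeOfRecord θ₀.ν θ₀.τ9.M _ p.K k _ (init_allLarge θ₀ p _ hall)
  have hW := WtOfRecord₁₃H_rePinH_door_seqAllLarge p (Stage13RParams.ofCured F N θ₀) rfl (k + 1)
  refine exists_clause_succ_rePinH_of_Omega_empty_of_sLaw₁₃CoPH_of_termLaws (Stage13HParams.ofHistoryBlind F N (Stage13RParams.ofCured F N θ₀)) p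
    h.ofCured.ofHistoryBlind hk hM hS _ rfl (fun t₀ E₀ => hA_of_allLarge θ₀ p hM _ hall _ _ t₀ E₀)
    (fun t₀ E₀ S => measurable_sect2Operand_CoP_of_allLarge θ₀ p hM _ (init_allLarge θ₀ p _ hall) _ t₀ E₀ S) (fun t₀ E₀ S hSm => ?_)
  have hS0 : S = fun _ => ∅ := by
    have this : S ∈ admSOfRecord F θ₀.ν θ₀.τ9.M (gOfRecord₁₃ F N θ₀ p) p.K k
        (seqAllLargeOfRecord F θ₀.ν θ₀.τ9.M (gOfRecord₁₃ F N θ₀ p) p.K (k + 1)).init := hSm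
    rw [admSOfRecord_init_eq_of_allLarge θ₀ p _ hall, Finset.mem_singleton] at this
    exact this
  subst hS0
  have hI := integrable_tkBranch_door_of_allLarge θ₀ p h hM (le_of_lt hk)
    ((Stage13HParams.ofHistoryBlind F N (Stage13RParams.ofCured F N θ₀)).rzAt p
      (seqAllLargeOfRecord F θ₀.ν θ₀.τ9.M (gOfRecord₁₃ F N θ₀ p) p.K (k + 1)).init) t₀ E₀ k le_rfl
  rw [← hinit] at hI
  have hW' : WtOfRecord₁₃H F N (rePinH (Stage13HParams.ofHistoryBlind F N (Stage13RParams.ofCured F N θ₀))) p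
      (seqAllLargeOfRecord F θ₀.ν θ₀.τ9.M (gOfRecord₁₃ F N θ₀ p) p.K (k + 1)) = WtOfRecord₁₃R F N (Stage13RParams.ofCured F N θ₀) p := hW
  rw [hW']
  exact hI

end Door

end Summit.QuantumFields.YangMills.Theorems.BalabanUVNodesN11NoExpansionGeneralStepRePinnedIntegrable

end
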